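import Literature.AlgebraicGeometry.Resolution.Kuhlmann2019HenselianRationality
import Literature.AlgebraicGeometry.Resolution.ValuationExtensionsConjugateGalois
import Mathlib.FieldTheory.PrimitiveElement
import Mathlib.Algebra.Polynomial.Lifts
import HarnessLib

/-!
# Henselian elements: proof of Kuhlmann–Novacoski 2014, Thm. 1.2 (finite subextensions of the henselization)

Topic: `Literature/AlgebraicGeometry/Resolution`. Proof companion of
`Kuhlmann2019HenselianRationality.lean`: it DISCHARGES the named fact `KuhlmannNovacoski2014_Thm12`
(F.-V. Kuhlmann, J. Novacoski, *Henselian elements*, J. Algebra 418 (2014) = arXiv:1311.6155,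
Thm. 1.2, valuative case, for a finite extension `F|L` inside the henselization `L^h`): there
is a unit `η ∈ O_F` with `F = L(η)` whose minimal polynomial `h` over `L` has coefficients in
`O_L` and `h'(η) ∈ O_F^×`.

Proof (the source's §3, pp. 7–8, in the case `F ⊆ L^h`, where the residue extension is trivial
and one may take `ϑ = 1`):

* `comap_ne_comap_of_ne_val` — **Lemma 3.2 with `k = 1`**: an `L`-embedding `φ : F → Ω` other
  than the inclusion induces a valuation ring `φ⁻¹(V) ≠ V ∩ F` on `F` (lift `φ` to
  `τ ∈ Gal(L^{sep}|L)`; if the rings agreed, the conjugation theorem over `F`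
  (`ValuationExtensionsConjugateGalois.lean`) would put `τρ` in the decomposition group for
  some `ρ ∈ Gal(L^{sep}|F)`, and the decomposition group fixes `L^h ⊇ F`, Def. 3.1).
* The finitely many rings `φ⁻¹(V)` lie over `O_L` and are pairwise incomparable
  (`ValuationRingsApproximation.lean`), so weak approximation gives `η ∈ F` with `η ≡ 1`
  modulo `𝔪_V` and `φ(η) ∈ 𝔪_V` for every `φ ≠ incl` (the source's Chinese remainder step).
* `h :=` the minimal polynomial of `η` over `L`; its roots in `Ω` are the `φ(η)`, all in `V`,
  so `h ∈ O_L[X]` (`h = ∏ (X - φ(η))`); `h` is separable and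
  `h'(η) = ∏_{φ(η) ≠ η} (η - φ(η))` is a unit (Lemma 3.3 (i)); every `L(η)`-embedding of `F`
  fixes `η`, hence is the inclusion, so `[F : L(η)] = 1`, i.e. `F = L(η)` (the source's
  "`σᵢ η ≠ η`" count).

## Source

* F.-V. Kuhlmann, J. Novacoski, *Henselian elements*, J. Algebra 418 (2014) 44–65 =
  arXiv:1311.6155: (1.1), Thm. 1.2 (p. 3); Def. 3.1, Lemma 3.2, Lemma 3.3, proof of Thm. 1.2
  (pp. 7–8).
-/

noncomputable section

open scoped Pointwise
open IntermediateField Polynomial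

namespace Literature.AlgebraicGeometry.Resolution

universe u

/-! ## Lemma 3.2: embeddings of a subfield of the henselization move the valuation -/

/-- **Kuhlmann–Novacoski 2014, Lemma 3.2 (case `k = 1`)**: for `Ω` algebraically closed,
`L ≤ Ω` valued by `V ∩ L`, an intermediate field `F` of `Ω|L` contained in the henselization
`L^h`, and an `L`-embedding `φ : F → Ω` different from the inclusion, the valuation rings
`φ⁻¹(V)` and `V ∩ F` of `F` differ. [cite: KuhlmannNovacoski2014, Lemma 3.2] -/
theorem comap_ne_comap_of_ne_val {Ω : Type u} [Field Ω] [IsAlgClosed Ω] (V : ValuationSubring Ω)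
    (L : Subfield Ω) (Fi : IntermediateField L Ω)
    (hF : ∀ x : Ω, x ∈ Fi → x ∈ henselization V L) (φ : Fi →ₐ[L] Ω) (hφ : φ ≠ Fi.val) :
    V.comap φ.toRingHom ≠ V.comap Fi.val.toRingHom := by
  intro heq
  -- `F ⊆ L^h ⊆ L^sep`, and `φ(F) ⊆ L^sep`
  set Ls : IntermediateField L Ω := separableClosure L Ω with hLs
  have hFiLs : ∀ x : Fi, (x : Ω) ∈ Ls := fun x =>
    henselization_le_separableClosure V L (hF x x.2)
  have hφinj : Function.Injective φ := φ.toRingHom.injective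
  have hφLs : ∀ x : Fi, φ x ∈ Ls := fun x => by
    rw [hLs, mem_separableClosure_iff, isSeparable_map_iff φ hφinj]
    exact (isSeparable_map_iff Fi.val Fi.val.toRingHom.injective).mp
      (mem_separableClosure_iff.mp (hFiLs x))
  -- `F → L^sep` as an algebra, and `φ` with values in `L^sep`
  let j : Fi →ₐ[L] Ls :=
    { toFun := fun x => ⟨x, hFiLs x⟩
      map_one' := rfl
      map_mul' := fun _ _ => rfl
      map_zero' := rfl
      map_add' := fun _ _ => rfl
      commutes' := fun _ => rfl }
  letI : Algebra Fi Ls := j.toRingHom.toAlgebra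
  haveI : IsScalarTower L Fi Ls := IsScalarTower.of_algebraMap_eq fun _ => rfl
  have halg : ∀ x : Fi, (algebraMap Fi Ls x : Ls) = ⟨(x : Ω), hFiLs x⟩ := fun x => rfl
  let φ' : Fi →ₐ[L] Ls :=
    { toFun := fun x => ⟨φ x, hφLs x⟩
      map_one' := Subtype.ext (map_one φ)
      map_mul' := fun a b => Subtype.ext (map_mul φ a b)
      map_zero' := Subtype.ext (map_zero φ)
      map_add' := fun a b => Subtype.ext (map_add φ a b)
      commutes' := fun c => Subtype.ext (φ.commutes c) }
  have hφ' : ∀ x : Fi, ((φ' x : Ls) : Ω) = φ x := fun x => rfl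
  -- lift `φ'` to `τ ∈ Gal(L^sep|L)`
  let τ₀ : Ls →ₐ[L] Ls := φ'.liftNormal Ls
  have hτ₀ : ∀ x : Fi, τ₀ (algebraMap Fi Ls x) = φ' x := fun x => by
    have h := AlgHom.liftNormal_commutes φ' Ls x
    rwa [Algebra.algebraMap_self, RingHom.id_apply] at h
  let τ : Ls ≃ₐ[L] Ls := AlgEquiv.ofBijective τ₀ (Algebra.IsAlgebraic.algHom_bijective τ₀)
  have hτ : ∀ y : Ls, τ y = τ₀ y := fun y => rfl
  -- the valuation rings `V ∩ L^sep` and `τ⁻¹(V ∩ L^sep)` agree on `F`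
  set W₀ : ValuationSubring Ls := sepClosureValuationSubring V L with hW₀
  set W₁ : ValuationSubring Ls := τ.symm • W₀ with hW₁
  have hW : W₀.comap (algebraMap Fi Ls) = W₁.comap (algebraMap Fi Ls) := by
    ext x
    rw [ValuationSubring.mem_comap, ValuationSubring.mem_comap, hW₁, ValuationSubring.mem_smul_iff,
      AlgEquiv.symm_symm, hτ, hτ₀, hW₀, mem_sepClosureValuationSubring_iff,
      mem_sepClosureValuationSubring_iff, halg, hφ']
    -- `x ∈ V ↔ φ x ∈ V` from the assumed equality of the two valuation rings of `F`
    exact (SetLike.ext_iff.mp heq x).symm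
  -- conjugation over `F` inside the Galois extension `L^sep|F`
  haveI : IsGalois Fi Ls := IsGalois.tower_top_of_isGalois L Fi Ls
  obtain ⟨ρ, hρ⟩ := ValuationSubring.exists_smul_eq_of_comap_eq_of_isGalois W₀ W₁ hW
  -- `σ = τ ∘ ρ` lies in the decomposition group
  set σ : Ls ≃ₐ[L] Ls := τ * ρ.restrictScalars L with hσ
  have hρ' : ρ.restrictScalars L • W₀ = ρ • W₀ := by
    ext y
    rw [ValuationSubring.mem_smul_iff, ValuationSubring.mem_smul_iff]
    rfl
  have hσW : σ • W₀ = W₀ := by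
    rw [hσ, mul_smul, hρ', hρ, hW₁, ← AlgEquiv.aut_inv, smul_inv_smul]
  have hσD : σ ∈ decompositionGroup V L := (mem_decompositionGroup_iff V L σ).mpr hσW
  -- hence `σ`, i.e. `φ`, fixes `F ⊆ L^h` pointwise
  apply hφ
  ext x
  obtain ⟨hxs, hfix⟩ := (mem_henselization_iff V L).mp (hF x x.2)
  have h1 := hfix σ hσD
  have h2 : (⟨(x : Ω), hxs⟩ : separableClosure L Ω) = algebraMap Fi Ls x := rfl
  have h3 : σ (algebraMap Fi Ls x) = φ' x := by
    rw [hσ, AlgEquiv.mul_apply, AlgEquiv.restrictScalars_apply, AlgEquiv.commutes, hτ, hτ₀]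
  rw [h2, h3] at h1
  have h4 := congrArg (fun y : Ls => (y : Ω)) h1
  simp only [hφ', halg] at h4
  change φ x = (x : Ω)
  exact h4


/-! ## Polynomials with roots in a valuation ring -/

/-- A product `∏ (X - r)` over a multiset of elements of `V` has all its coefficients in `V`.
[folklore] -/
theorem coeff_multiset_prod_X_sub_C_mem {Ω : Type u} [Field Ω] (V : ValuationSubring Ω)
    (t : Multiset Ω) (ht : ∀ r ∈ t, r ∈ V) (k : ℕ) :
    ((t.map fun r => X - C r).prod).coeff k ∈ V := by
  have hl : (t.map fun r => X - C r).prod ∈ Polynomial.lifts V.subtype := by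
    refine Subsemiring.multiset_prod_mem _ _ fun q hq => ?_
    obtain ⟨r, hr, rfl⟩ := Multiset.mem_map.mp hq
    have : (X - C r : Polynomial Ω) = X + C (V.subtype ⟨-r, V.neg_mem _ (ht r hr)⟩) := by
      rw [sub_eq_add_neg, ← C_neg]
      rfl
    rw [this]
    exact add_mem (Polynomial.X_mem_lifts _) (Polynomial.C_mem_lifts _ _)
  obtain ⟨c, hc⟩ := (Polynomial.lifts_iff_coeff_lifts _).mp hl k
  rw [← hc]
  exact c.2

/-! ## Thm. 1.2 -/

/-- **Kuhlmann–Novacoski 2014, Thm. 1.2 (valuative case, `F ⊆ L^h`)** — DISCHARGE of the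
named fact `KuhlmannNovacoski2014_Thm12` of `Kuhlmann2019HenselianRationality.lean`.
[cite: KuhlmannNovacoski2014, Thm. 1.2] -/
theorem KuhlmannNovacoski2014_Thm12_holds : KuhlmannNovacoski2014_Thm12.{u} := by
  intro Ω _ _ V L F hLF hfin hFh
  classical
  -- `F` as a finite-dimensional intermediate field `Fi` of `Ω|L`
  obtain ⟨s, hsalg, hs⟩ := hfin
  set Fi : IntermediateField L Ω := IntermediateField.adjoin L (s : Set Ω) with hFi_def
  have hFi : ∀ x : Ω, x ∈ Fi ↔ x ∈ F := fun x => by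
    rw [hFi_def, mem_adjoin_iff_mem_closure, hs]
  haveI : FiniteDimensional L Fi := IntermediateField.finiteDimensional_adjoin
    fun x hx => (hsalg x (Finset.mem_coe.mp hx)).isIntegral
  haveI : Algebra.IsAlgebraic L Fi := Algebra.IsAlgebraic.of_finite L Fi
  have hFh' : ∀ x : Ω, x ∈ Fi → x ∈ henselization V L := fun x hx => hFh ((hFi x).mp hx)
  haveI : Algebra.IsSeparable L Fi := ⟨fun x =>
    (isSeparable_map_iff Fi.val Fi.val.toRingHom.injective).mp
      (isSeparable_of_mem_henselization V L (hFh' x x.2))⟩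
  -- the `L`-embeddings of `F` and the valuation rings they induce
  set val : Fi →ₐ[L] Ω := Fi.val with hval
  set R : (Fi →ₐ[L] Ω) → ValuationSubring Fi := fun φ => V.comap φ.toRingHom with hR
  have hRO : ∀ φ, (R φ).comap (algebraMap L Fi) = (R val).comap (algebraMap L Fi) := by
    intro φ
    ext c
    change φ (algebraMap L Fi c) ∈ V ↔ val (algebraMap L Fi c) ∈ V
    rw [φ.commutes, val.commutes]
  have hkey : ∀ φ, φ ≠ val → R φ ≠ R val := fun φ hφ =>
    comap_ne_comap_of_ne_val V L Fi hFh' φ hφ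
  -- weak approximation in the finite, pairwise incomparable family `{R φ}`
  set S : Finset (ValuationSubring Fi) := (Finset.univ : Finset (Fi →ₐ[L] Ω)).image R with hS
  have hmemS : ∀ φ, R φ ∈ S := fun φ => Finset.mem_image.mpr ⟨φ, Finset.mem_univ _, rfl⟩
  have hinc : ∀ i j : S, (i : ValuationSubring Fi) ≤ j → i = j := by
    intro i j hij
    by_contra hne
    obtain ⟨φ, -, hφ⟩ := Finset.mem_image.mp i.2
    obtain ⟨ψ, -, hψ⟩ := Finset.mem_image.mp j.2
    have hne' : (i : ValuationSubring Fi) ≠ j := fun h => hne (Subtype.ext h)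
    have hO : (i : ValuationSubring Fi).comap (algebraMap L Fi) =
        (j : ValuationSubring Fi).comap (algebraMap L Fi) := by
      rw [← hφ, ← hψ, hRO φ, hRO ψ]
    exact ValuationSubring.not_le_of_ne_of_comap_eq hne' hO hij
  obtain ⟨η₀, hηmem, hη1, hηlt⟩ := ValuationSubring.exists_crt_of_forall_le_imp_eq
    (fun i : S => (i : ValuationSubring Fi)) hinc ⟨R val, hmemS val⟩
  have hηall : ∀ φ : Fi →ₐ[L] Ω, φ η₀ ∈ V := fun φ => hηmem ⟨R φ, hmemS φ⟩
  have hηφ : ∀ φ : Fi →ₐ[L] Ω, φ ≠ val → V.valuation (φ η₀) < 1 := fun φ hφ =>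
    (valuation_map_lt_one_iff φ.toRingHom (V := V.comap φ.toRingHom) rfl η₀).mpr
      (hηlt ⟨R φ, hmemS φ⟩ fun h => hkey φ hφ (congrArg Subtype.val h))
  set η : Ω := (η₀ : Ω) with hη
  have hηsub : V.valuation (η - 1) < 1 := by
    have h := (valuation_map_lt_one_iff val.toRingHom (V := V.comap val.toRingHom) rfl
      (η₀ - 1)).mpr hη1
    rwa [AlgHom.toRingHom_eq_coe, RingHom.coe_coe, map_sub, map_one] at h
  have hηunit : V.valuation η = 1 := ValuationSubring.valuation_eq_one_of_sub_one V hηsub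
  have hηF : η ∈ F := (hFi η).mp η₀.2
  -- an embedding with `v(φ η) = 1` is the inclusion
  have hφval : ∀ φ : Fi →ₐ[L] Ω, φ η₀ = η → φ = val := by
    intro φ hφη
    by_contra hne
    have := hηφ φ hne
    rw [hφη, hηunit] at this
    exact lt_irrefl _ this
  -- the minimal polynomial `h` of `η` over `L`, inside `Ω[X]`
  set m : Polynomial L := minpoly L η₀ with hm
  set h : Polynomial Ω := m.map (algebraMap L Ω) with hh
  have hint : IsIntegral L η₀ := Algebra.IsIntegral.isIntegral η₀
  have hmsep : m.Separable := Algebra.IsSeparable.isSeparable L η₀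
  have hmonic : h.Monic := (minpoly.monic hint).map _
  have hhsep : h.Separable := hmsep.map
  have hh0 : h ≠ 0 := hmonic.ne_zero
  have hsplit : h.Splits := IsAlgClosed.splits h
  have hhη : h.eval η = 0 := by
    rw [hh, Polynomial.eval_map, ← Polynomial.aeval_def, hη,
      show ((η₀ : Fi) : Ω) = algebraMap Fi Ω η₀ from rfl, Polynomial.aeval_algebraMap_apply,
      hm, minpoly.aeval, map_zero]
  -- the roots of `h` in `Ω` are the `φ η`
  have hroots : ∀ r : Ω, r ∈ h.roots ↔ ∃ φ : Fi →ₐ[L] Ω, φ η₀ = r := by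
    intro r
    have hset := Algebra.IsAlgebraic.range_eval_eq_rootSet_minpoly (F := L) Ω η₀
    have : r ∈ (minpoly L η₀).rootSet Ω ↔ r ∈ h.roots := by
      rw [Polynomial.mem_rootSet, Polynomial.mem_roots hh0, Polynomial.IsRoot.def, hh, hm,
        Polynomial.eval_map, ← Polynomial.aeval_def]
      exact ⟨fun h => h.2, fun h => ⟨minpoly.ne_zero hint, h⟩⟩
    rw [← this, ← hset, Set.mem_range]
  have hηroot : η ∈ h.roots := (hroots η).mpr ⟨val, rfl⟩
  -- coefficients of `h` lie in `V` (all roots do) and in `L`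
  have hcoefV : ∀ k, h.coeff k ∈ V := by
    intro k
    rw [hsplit.eq_prod_roots_of_monic hmonic]
    refine coeff_multiset_prod_X_sub_C_mem V h.roots (fun r hr => ?_) k
    obtain ⟨φ, rfl⟩ := (hroots r).mp hr
    exact hηall φ
  have hcoefL : ∀ k, h.coeff k ∈ L := fun k => by
    rw [hh, Polynomial.coeff_map]
    exact (m.coeff k).2
  -- `h'(η)` is a unit: the other roots `φ η`, `φ ≠ incl`, lie in `𝔪_V`
  have hder : V.valuation ((derivative h).eval η) = 1 := by
    rw [hsplit.eval_root_derivative hmonic hηroot, map_multiset_prod, Multiset.map_map]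
    refine Multiset.prod_eq_one fun x hx => ?_
    obtain ⟨r, hr, rfl⟩ := Multiset.mem_map.mp hx
    obtain ⟨hrη, hr'⟩ := ((nodup_roots hhsep).mem_erase_iff).mp hr
    obtain ⟨φ, rfl⟩ := (hroots _).mp hr'
    have hφne : φ ≠ val := fun h => hrη (by rw [h]; rfl)
    change V.valuation (η - φ η₀) = 1
    rw [V.valuation.map_sub_eq_of_lt_left (by rw [hηunit]; exact hηφ φ hφne), hηunit]
  -- `F = L(η)`: every `L(η)`-embedding of `F` into `Ω` fixes `η`, hence is the inclusion
  set K : IntermediateField L Fi := IntermediateField.adjoin L {η₀} with hK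
  let valK : Fi →ₐ[K] Ω := ⟨Fi.val.toRingHom, fun _ => rfl⟩
  haveI : Algebra.IsSeparable K Fi := Algebra.isSeparable_tower_top_of_isSeparable L K Fi
  have hηK : η₀ ∈ K := IntermediateField.mem_adjoin_simple_self L η₀
  have hfix : ∀ ψ : Fi →ₐ[K] Ω, ψ.restrictScalars L = val := fun ψ => by
    apply hφval
    have h1 : (algebraMap K Fi ⟨η₀, hηK⟩ : Fi) = η₀ := rfl
    rw [AlgHom.restrictScalars_apply, ← h1, ψ.commutes]
    rfl
  have hsub : ∀ ψ₁ ψ₂ : Fi →ₐ[K] Ω, ψ₁ = ψ₂ := fun ψ₁ ψ₂ =>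
    AlgHom.restrictScalars_injective L (by rw [hfix ψ₁, hfix ψ₂])
  have hcard : Module.finrank K Fi = 1 := by
    rw [← AlgHom.card K Fi Ω]
    refine le_antisymm (Fintype.card_le_one_iff.mpr hsub) ?_
    exact Fintype.card_pos_iff.mpr ⟨valK⟩
  have hKtop : K = ⊤ := IntermediateField.finrank_eq_one_iff_eq_top.mp hcard
  -- hence `F = L(η)` as subfields of `Ω`
  have hgen : Subfield.closure ((L : Set Ω) ∪ {η}) = F := by
    refine le_antisymm (Subfield.closure_le.mpr (Set.union_subset hLF
      (Set.singleton_subset_iff.mpr hηF))) fun z hz => ?_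
    have hzK : (⟨z, (hFi z).mpr hz⟩ : Fi) ∈ K := by
      rw [hKtop]
      exact IntermediateField.mem_top
    have hzmap : z ∈ (K.map Fi.val : IntermediateField L Ω) :=
      (IntermediateField.mem_map K).mpr ⟨⟨z, (hFi z).mpr hz⟩, hzK, rfl⟩
    rw [hK, IntermediateField.adjoin_map, Set.image_singleton] at hzmap
    exact (mem_adjoin_iff_mem_closure L {η} z).mp hzmap
  -- minimality of `h` among the polynomials over `L` vanishing at `η`
  have hmin : ∀ q : Polynomial Ω, q ≠ 0 → (∀ k, q.coeff k ∈ L) → q.eval η = 0 →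
      h.degree ≤ q.degree := by
    intro q hq0 hqL hqη
    have hql : q ∈ Polynomial.lifts (algebraMap L Ω) := by
      rw [Polynomial.lifts_iff_coeff_lifts]
      intro k
      exact ⟨⟨q.coeff k, hqL k⟩, rfl⟩
    obtain ⟨q₀, hq₀, hdeg⟩ := Polynomial.exists_degree_eq_of_mem_lifts hql
    have hq₀0 : q₀ ≠ 0 := by
      rintro rfl
      rw [Polynomial.map_zero] at hq₀
      exact hq0 hq₀.symm
    have hq₀η : aeval η₀ q₀ = 0 := by
      apply (algebraMap Fi Ω).injective
      rw [← Polynomial.aeval_algebraMap_apply, map_zero,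
        show algebraMap Fi Ω η₀ = η from rfl, Polynomial.aeval_def, ← Polynomial.eval_map, hq₀, hqη]
    rw [hh, Polynomial.degree_map, ← hdeg, hm]
    exact minpoly.degree_le_of_ne_zero L η₀ hq₀0 hq₀η
  exact ⟨η, hηF, hηunit, hgen, h, hmonic, fun k => ⟨hcoefV k, hcoefL k⟩, hhη, hmin, hder⟩

/-- **Knaf–Kuhlmann 2009, Thm. 3.8 (separably closed ground field, Hensel-root form) from
henselian rationality alone**: with `KuhlmannNovacoski2014_Thm12` discharged, the named fact
`KnafKuhlmann2009_Thm38_sepClosed` follows from `Kuhlmann2019_Thm13_sepClosed` (Kuhlmann 2019,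
Thm. 1.3), which is therefore its whole trust base. [cite: KnafKuhlmann2009, Thm. 3.8] -/
theorem KnafKuhlmann2009_Thm38_sepClosed.of_thm13 (hH : Kuhlmann2019_Thm13_sepClosed.{u}) :
    KnafKuhlmann2009_Thm38_sepClosed.{u} :=
  KnafKuhlmann2009_Thm38_sepClosed.of_henselianRational hH KuhlmannNovacoski2014_Thm12_holds

end Literature.AlgebraicGeometry.Resolution

end
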